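import Literature.NumberTheory.Sieve.FriedlanderIwaniecPrimesLemma31Poisson
import Literature.NumberTheory.Sieve.FriedlanderIwaniecPrimesLemma31Counting
import Literature.NumberTheory.Sieve.FriedlanderIwaniecPrimesMainTermProofs
import HarnessLib

/-!
# Friedlander–Iwaniec, *The polynomial `X² + Y⁴` captures its primes*, Lemma 3.1: smoothing and the decomposition of `A_d(x) - M_d(x)`

Family `parity`, statement parity.S17. Source: J. Friedlander, H. Iwaniec, Ann. of Math. (2) 148
(1998), 945–1040 [FriedlanderIwaniecAnnals1998], §3, proof of Lemma 3.1 (arXiv pp. 11–12):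
"We begin by smoothing the sum `A_d(x)` with a function `f(u)` … By a trivial estimation the
difference is (3.10) `∑_{d ≤ D} |A_d(x) - A_d(f)| ≪ y x^{-1/4+ε}` … It is convenient to first remove
the contribution coming from terms with `b = 0` … The main term comes from `k = 0` which gives
`M_d(f) = (2/d) ∑_b 𝔷(b) ρ(b; d) I(0, b; d)`. Since in this case the integral approximates to the sum
… the difference between the expected main terms satisfies (3.12)
`∑_{d ≤ D} |M_d(f) - M_d(x)| ≪ y x^{-1/4} (log x)²`."

This file sets up that decomposition for the tree's objects `A_d(x) = fiSieveSeq.congrSum d x`,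
`M_d(x) = fiMainTerm d x` and PROVES the elementary comparisons (our (3.12) uses the Poisson
expansion at `d = 1` instead of FI's comparison of sum and integral, which reduces it to the same
strip count as (3.10)):

* `fiCRange N = {c ≠ 0 : c⁴ ≤ N}`; the bridges `sqCongrCount d (-c⁴) = ρ(c²; d) = #fiRoots |c|² d`,
  `sqCongrCount d 0 = #fiRoots 0 d`;
* the `c = 0` / `c ≠ 0` splittings `congrSum_eq_fiAzero_add_fiAstar`, `fiMainTerm_eq_fiMzero_add_fiMstar`
  with `0 ≤ fiAzero ≤ #{a ≠ 0 : a² ≤ ⌊x⌋, d ∣ a²}`, `0 ≤ fiMzero ≤ 2√x ρ(0; d)/d`;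
* the smoothed objects `fiAstarSmooth` (`= ∑_{c} A_d^{(c)}(f)`, real parts of `fiSmoothSlice`),
  `fiMstarSmooth` (`= d⁻¹ ∑_c ρ(c²; d) 𝓕F_c(0)`) and the oscillatory remainder
  `fiE x y d = fiAstarSmooth - fiMstarSmooth`;
* **(3.10)** `fiAstar_sub_smooth_mem`: `0 ≤ A*_d(x) - A*_d(f) ≤ #{strip points divisible by d}`;
* **(3.12)** `abs_fiMstar_sub_smooth_le`: `|M*_d(x) - M*_d(f)| ≤ d⁻¹ ∑_c ρ(c²;d)(strip_c + |P_c|)`,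
  `P_c = ∑_a F_c(a) - 𝓕F_c(0)` the Poisson error at `d = 1` (`sum_profile_eq_fourier_zero_add`,
  `abs_poissonError_le`);
* the pointwise decomposition `abs_congrSum_sub_fiMainTerm_le`.

## References

* J. Friedlander, H. Iwaniec, Ann. of Math. (2) 148 (1998), 945–1040, §3, (3.10)–(3.12).
  [cite: FriedlanderIwaniecAnnals1998, §3 (3.10)-(3.12)]

## Mathlib / tree search

Tree: `fiSmoothSlice`, `fiSmoothSlice_eq_tsum`, `tsum_dual_eq`, `fiWeylInt` (`…Lemma31Poisson`);
`fiRoots`, `card_fiRoots_le` (`…WeylHarmonics`); `congrSum_eq_card`, `sqCongrCount`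
(`…CrudeBound`); `mul_fiMainTerm_eq`, `fiDisc_eq_insert_fiPoints`, `origin_not_mem_fiPoints`
(`…MainTermProofs`); `card_slice_eq_zero`, `fiPoints`, `fiDisc`, `fiBox` (`FriedlanderIwaniecPrimes`);
`fiCutoff_eq_one`, `fiCutoff_eq_zero`, `fiCutoff_mem_Icc` (`…SmoothCutoff`).
-/

noncomputable section

open Finset Real MeasureTheory Filter Complex
open scoped FourierTransform ContDiff

namespace Literature.NumberTheory.Sieve.FriedlanderIwaniecPrimes

/-! ### The range of `c` and the bridges to `sqCongrCount` -/

/-- The nonzero `c` with `c⁴ ≤ N`: `0 < |c| ≤ ⌊N^{1/4}⌋`. [folklore] -/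
def fiCRange (N : ℕ) : Finset ℤ :=
  (Icc (-(Nat.sqrt (Nat.sqrt N) : ℤ)) (Nat.sqrt (Nat.sqrt N))).filter (· ≠ 0)

/-- `n ≤ ⌊√⌊√N⌋⌋ ↔ n⁴ ≤ N` for naturals. [folklore] -/
theorem le_sqrt_sqrt_iff (n N : ℕ) : n ≤ Nat.sqrt (Nat.sqrt N) ↔ n ^ 4 ≤ N := by
  rw [Nat.le_sqrt, Nat.le_sqrt, show n ^ 4 = n * n * (n * n) by ring]

/-- `(|c| : ℤ)` and `c⁴`. [folklore] -/
theorem pow_four_eq_natAbs (c : ℤ) : c ^ 4 = ((c.natAbs ^ 4 : ℕ) : ℤ) := by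
  push_cast
  rw [Even.pow_abs ⟨2, rfl⟩]

/-- Membership in `fiCRange`: `c ≠ 0` and `c⁴ ≤ N`. [folklore] -/
theorem mem_fiCRange {N : ℕ} {c : ℤ} : c ∈ fiCRange N ↔ c ≠ 0 ∧ c ^ 4 ≤ (N : ℤ) := by
  rw [fiCRange, mem_filter, mem_Icc, ← abs_le, and_comm]
  refine and_congr_right fun _ => ?_
  rw [show |c| = (c.natAbs : ℤ) from (Int.natCast_natAbs c).symm, Int.ofNat_le, le_sqrt_sqrt_iff,
    pow_four_eq_natAbs, Int.ofNat_le]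

/-- The nonzero `c ∈ [-N, N]` with `c⁴ ≤ N` are exactly `fiCRange N`. [folklore] -/
theorem filter_Icc_eq_fiCRange (N : ℕ) :
    (Icc (-(N : ℤ)) N).filter (fun c => c ≠ 0 ∧ c ^ 4 ≤ (N : ℤ)) = fiCRange N := by
  ext c
  rw [mem_filter, mem_fiCRange, mem_Icc]
  constructor
  · exact fun h => h.2
  · rintro ⟨hc0, hc4⟩
    refine ⟨?_, hc0, hc4⟩
    have h1 : |c| ≤ c ^ 4 := by
      rw [← Even.pow_abs ⟨2, rfl⟩]
      have : 1 ≤ |c| := Int.one_le_abs hc0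
      calc |c| = |c| ^ 1 := (pow_one _).symm
        _ ≤ |c| ^ 4 := pow_le_pow_right₀ this (by norm_num)
    exact abs_le.mp (h1.trans hc4)

/-- **Bridge**: `sqCongrCount d (-c⁴) = ρ(c²; d) = #fiRoots |c|² d` (FI's `ρ(b; d)` with `b = c²`).
[cite: FriedlanderIwaniecAnnals1998, §3, ρ(b; d)] -/
theorem sqCongrCount_neg_pow_four_eq_card (d : ℕ) (c : ℤ) :
    sqCongrCount d (-c ^ 4) = #(fiRoots (c.natAbs ^ 2) d) := by
  unfold sqCongrCount fiRoots
  congr 1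
  ext ν
  simp only [mem_filter, mem_range, and_congr_right_iff]
  intro _
  rw [sub_neg_eq_add, show (ν : ℤ) ^ 2 + c ^ 4 = ((ν ^ 2 + (c.natAbs ^ 2) ^ 2 : ℕ) : ℤ) by
    rw [pow_four_eq_natAbs]; push_cast; ring, Int.natCast_dvd_natCast]

/-- **Bridge**: `sqCongrCount d 0 = ρ(0; d) = #fiRoots 0 d`. [cite: FriedlanderIwaniecAnnals1998, §3, ρ(0; d)] -/
theorem sqCongrCount_zero_eq_card (d : ℕ) : sqCongrCount d 0 = #(fiRoots 0 d) := by
  have h := sqCongrCount_neg_pow_four_eq_card d 0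
  simpa using h

/-! ### `A_d(x)` split by `c = 0` / `c ≠ 0` -/

/-- `A*_d(x)`: the points `(a, c)`, `c ≠ 0`, `1 ≤ a² + c⁴ ≤ ⌊x⌋`, `d ∣ a² + c⁴`.
[cite: FriedlanderIwaniecAnnals1998, §3, "remove the contribution coming from terms with b = 0"] -/
def fiAstar (x : ℝ) (d : ℕ) : ℕ := #{P ∈ fiPoints ⌊x⌋₊ | d ∣ fiQuartic P ∧ P.2 ≠ 0}

/-- `A⁰_d(x)`: the points `(a, 0)`, `1 ≤ a² ≤ ⌊x⌋`, `d ∣ a²`.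
[cite: FriedlanderIwaniecAnnals1998, §3, terms with b = 0] -/
def fiAzero (x : ℝ) (d : ℕ) : ℕ := #{P ∈ fiPoints ⌊x⌋₊ | d ∣ fiQuartic P ∧ P.2 = 0}

/-- `A_d(x) = A⁰_d(x) + A*_d(x)`. [cite: FriedlanderIwaniecAnnals1998, §3] -/
theorem congrSum_eq_fiAzero_add_fiAstar (d : ℕ) (x : ℝ) :
    fiSieveSeq.congrSum d x = fiAzero x d + fiAstar x d := by
  rw [congrSum_eq_card, fiAzero, fiAstar]
  have h := card_filter_add_card_filter_not (s := {P ∈ fiPoints ⌊x⌋₊ | d ∣ fiQuartic P})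
    (p := fun P : ℤ × ℤ => P.2 = 0)
  rw [filter_filter, filter_filter] at h
  exact_mod_cast h.symm

/-- `d ∣ q(a, c)` as naturals iff `(d : ℤ) ∣ a² + c⁴`. [folklore] -/
theorem dvd_fiQuartic_iff (d : ℕ) (P : ℤ × ℤ) : d ∣ fiQuartic P ↔ (d : ℤ) ∣ P.1 ^ 2 + P.2 ^ 4 := by
  rw [← fiQuartic_cast, Int.natCast_dvd_natCast]

/-- **`A*_d(x)` sliced**: `A*_d(x) = ∑_{c ∈ fiCRange} #{a : a² + c⁴ ≤ ⌊x⌋, d ∣ a² + c⁴}`.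
[cite: FriedlanderIwaniecAnnals1998, §3, A_d = ∑_b 𝔷(b) …] -/
theorem fiAstar_eq_sum (x : ℝ) (d : ℕ) :
    (fiAstar x d : ℝ) = ∑ c ∈ fiCRange ⌊x⌋₊, (#{a ∈ Icc (-(⌊x⌋₊ : ℤ)) ⌊x⌋₊ |
      a ^ 2 + c ^ 4 ≤ (⌊x⌋₊ : ℤ) ∧ (d : ℤ) ∣ a ^ 2 + c ^ 4} : ℝ) := by
  set N := ⌊x⌋₊ with hN
  -- as a sum over the box
  have h1 : (fiAstar x d : ℝ) = ∑ c ∈ Icc (-(N : ℤ)) N, (#{a ∈ Icc (-(N : ℤ)) N |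
      a ^ 2 + c ^ 4 ≤ (N : ℤ) ∧ (d : ℤ) ∣ a ^ 2 + c ^ 4 ∧ c ≠ 0} : ℝ) := by
    rw [fiAstar, fiPoints, filter_filter, fiBox, card_eq_sum_ones, sum_filter, sum_product_right]
    push_cast
    refine sum_congr rfl fun c _ => ?_
    rw [card_eq_sum_ones, sum_filter]
    push_cast
    refine sum_congr rfl fun a _ => ?_
    have hq : fiQuartic (a, c) ∈ Icc 1 N ∧ d ∣ fiQuartic (a, c) ∧ (a, c).2 ≠ 0 ↔
        a ^ 2 + c ^ 4 ≤ (N : ℤ) ∧ (d : ℤ) ∣ a ^ 2 + c ^ 4 ∧ c ≠ 0 := by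
      rw [dvd_fiQuartic_iff, mem_Icc]
      constructor
      · rintro ⟨⟨-, h2⟩, h3, h4⟩
        refine ⟨?_, h3, h4⟩
        have := (Int.ofNat_le).mpr h2
        rwa [fiQuartic_cast] at this
      · rintro ⟨h2, h3, h4⟩
        refine ⟨⟨?_, ?_⟩, h3, h4⟩
        · -- `1 ≤ q` since `c ≠ 0`
          have : (1 : ℤ) ≤ fiQuartic (a, c) := by
            rw [fiQuartic_cast]
            have hc : 1 ≤ c ^ 4 := by
              have := Int.one_le_abs h4
              calc (1 : ℤ) = 1 ^ 4 := by norm_num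
                _ ≤ |c| ^ 4 := pow_le_pow_left₀ zero_le_one this 4
                _ = c ^ 4 := Even.pow_abs ⟨2, rfl⟩ c
            nlinarith [sq_nonneg a]
          exact_mod_cast this
        · have : (fiQuartic (a, c) : ℤ) ≤ N := by rw [fiQuartic_cast]; exact h2
          exact_mod_cast this
    split_ifs with hA hB hB
    · rfl
    · exact absurd (hq.mp hA) hB
    · exact absurd (hq.mpr hB) hA
    · rfl
  rw [h1]
  -- restrict to `fiCRange`
  symm
  refine (sum_congr rfl fun c hc => ?_).trans (sum_subset (fun c hc => ?_) (fun c _ hc' => ?_))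
  · rw [← filter_Icc_eq_fiCRange] at hc
    have hc0 : c ≠ 0 := (mem_filter.mp hc).2.1
    norm_cast
    congr 1
    ext a
    simp only [mem_filter]
    tauto
  · rw [← filter_Icc_eq_fiCRange] at hc
    exact (mem_filter.mp hc).1
  · -- outside `fiCRange` the slice is empty
    rw [mem_fiCRange, not_and_or, not_not, not_le] at hc'
    norm_cast
    rw [card_eq_zero, filter_eq_empty_iff]
    intro a _ hp
    rcases hc' with hc' | hc'
    · exact hp.2.2 hc'
    · nlinarith [sq_nonneg a, hp.1]

/-- `A⁰_d(x) ≤ #{a ≠ 0 : a² ≤ ⌊x⌋, d ∣ a²}`. [cite: FriedlanderIwaniecAnnals1998, §3, terms with b = 0] -/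
theorem fiAzero_le (x : ℝ) (d : ℕ) :
    fiAzero x d ≤ #{a ∈ Icc (-(⌊x⌋₊ : ℤ)) ⌊x⌋₊ | a ≠ 0 ∧ a ^ 2 ≤ (⌊x⌋₊ : ℤ) ∧ (d : ℤ) ∣ a ^ 2} := by
  rw [fiAzero]
  refine card_le_card_of_injOn (fun P => P.1) (fun P hP => ?_) (fun P hP Q hQ h => ?_)
  · have hP' := mem_filter.mp (mem_coe.mp hP)
    obtain ⟨hPts, hd, hc⟩ := hP'
    rw [fiPoints, mem_filter, mem_Icc, fiBox, mem_product] at hPts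
    rw [dvd_fiQuartic_iff, hc] at hd
    simp only [ne_eq, OfNat.ofNat_ne_zero, not_false_eq_true, zero_pow, add_zero] at hd
    have hq : (fiQuartic P : ℤ) = P.1 ^ 2 := by rw [fiQuartic_cast, hc]; ring
    refine mem_coe.mpr (mem_filter.mpr ⟨hPts.1.1, ?_, ?_, hd⟩)
    · intro h0
      change P.1 = 0 at h0
      have : (1 : ℤ) ≤ fiQuartic P := by exact_mod_cast hPts.2.1
      rw [hq, h0] at this
      norm_num at this
    · have : (fiQuartic P : ℤ) ≤ ⌊x⌋₊ := by exact_mod_cast hPts.2.2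
      rwa [hq] at this
  · have hP2 := (mem_filter.mp (mem_coe.mp hP)).2.2
    have hQ2 := (mem_filter.mp (mem_coe.mp hQ)).2.2
    exact Prod.ext h (hP2.trans hQ2.symm)

/-- The nonzero `a` with `a² ≤ N` number at most `2√N`. [folklore] -/
theorem card_nonzero_sq_le (N : ℕ) :
    (#{a ∈ Icc (-(N : ℤ)) N | a ≠ 0 ∧ a ^ 2 ≤ (N : ℤ)} : ℝ) ≤ 2 * Real.sqrt N := by
  set s := Nat.sqrt N with hs
  have hsub : {a ∈ Icc (-(N : ℤ)) N | a ≠ 0 ∧ a ^ 2 ≤ (N : ℤ)} ⊆ (Icc (-(s : ℤ)) s).erase 0 := by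
    intro a ha
    rw [mem_filter] at ha
    rw [mem_erase, mem_Icc, ← abs_le]
    refine ⟨ha.2.1, ?_⟩
    rw [show |a| = (a.natAbs : ℤ) from (Int.natCast_natAbs a).symm, Int.ofNat_le, Nat.le_sqrt']
    have : ((a.natAbs ^ 2 : ℕ) : ℤ) ≤ N := by push_cast; rw [sq_abs]; exact ha.2.2
    exact_mod_cast this
  have hcard : #((Icc (-(s : ℤ)) s).erase 0) = 2 * s := by
    rw [card_erase_of_mem (by simp), Int.card_Icc]
    omega
  calc (#{a ∈ Icc (-(N : ℤ)) N | a ≠ 0 ∧ a ^ 2 ≤ (N : ℤ)} : ℝ) ≤ (2 * s : ℕ) := by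
        rw [← hcard]; exact_mod_cast card_le_card hsub
    _ ≤ 2 * Real.sqrt N := by
        push_cast
        have hsq : s ^ 2 ≤ N := Nat.sqrt_le' N
        have h2 : (s : ℝ) ≤ Real.sqrt N := by
          rw [Real.le_sqrt (Nat.cast_nonneg _) (Nat.cast_nonneg _)]
          exact_mod_cast hsq
        linarith

/-- **`∑_{d ≤ D} A⁰_d(x) ≤ 2√x · T`** where `τ(n) ≤ T` for `1 ≤ n ≤ ⌊x⌋`.
[cite: FriedlanderIwaniecAnnals1998, §3, "≪ √x/(d₁d₂)" (here bounded via the divisor function)] -/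
theorem sum_fiAzero_le {x : ℝ} {T : ℕ} (hT : ∀ n : ℕ, n ≠ 0 → n ≤ ⌊x⌋₊ → #n.divisors ≤ T)
    (D : ℕ) : ∑ d ∈ Icc 1 D, (fiAzero x d : ℝ) ≤ 2 * Real.sqrt x * T := by
  set N := ⌊x⌋₊ with hN
  set S := {a ∈ Icc (-(N : ℤ)) N | a ≠ 0 ∧ a ^ 2 ≤ (N : ℤ)} with hS
  calc ∑ d ∈ Icc 1 D, (fiAzero x d : ℝ)
      ≤ ∑ d ∈ Icc 1 D, (#{a ∈ S | (d : ℤ) ∣ a ^ 2} : ℝ) := by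
        refine sum_le_sum fun d _ => ?_
        have h := fiAzero_le x d
        rw [← hN] at h
        have : {a ∈ Icc (-(N : ℤ)) N | a ≠ 0 ∧ a ^ 2 ≤ (N : ℤ) ∧ (d : ℤ) ∣ a ^ 2} =
            {a ∈ S | (d : ℤ) ∣ a ^ 2} := by
          rw [hS, filter_filter]
          simp only [and_assoc]
        rw [this] at h
        exact_mod_cast h
    _ = ∑ a ∈ S, (#((Icc 1 D).filter fun d : ℕ => (d : ℤ) ∣ a ^ 2) : ℝ) := by
        simp only [card_filter, Nat.cast_sum, Nat.cast_ite, Nat.cast_one, Nat.cast_zero]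
        exact sum_comm
    _ ≤ ∑ a ∈ S, (T : ℝ) := by
        refine sum_le_sum fun a ha => ?_
        rw [hS, mem_filter] at ha
        have ha0 : a.natAbs ≠ 0 := Int.natAbs_ne_zero.mpr ha.2.1
        have hle : a.natAbs ^ 2 ≤ N := by
          have : ((a.natAbs ^ 2 : ℕ) : ℤ) ≤ N := by push_cast; rw [sq_abs]; exact ha.2.2
          exact_mod_cast this
        have hsub : ((Icc 1 D).filter fun d : ℕ => (d : ℤ) ∣ a ^ 2) ⊆ (a.natAbs ^ 2).divisors := by
          intro d hd
          rw [mem_filter] at hd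
          rw [Nat.mem_divisors]
          refine ⟨?_, pow_ne_zero 2 ha0⟩
          have := hd.2
          rw [← Int.natAbs_sq a, show ((a.natAbs : ℤ)) ^ 2 = ((a.natAbs ^ 2 : ℕ) : ℤ) by push_cast; ring,
            Int.natCast_dvd_natCast] at this
          exact this
        calc (#((Icc 1 D).filter fun d : ℕ => (d : ℤ) ∣ a ^ 2) : ℝ) ≤ #(a.natAbs ^ 2).divisors := by
              exact_mod_cast card_le_card hsub
          _ ≤ T := by exact_mod_cast hT _ (pow_ne_zero 2 ha0) hle
    _ = #S * T := by rw [sum_const, nsmul_eq_mul]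
    _ ≤ 2 * Real.sqrt N * T := by
        gcongr
        exact card_nonzero_sq_le N
    _ ≤ 2 * Real.sqrt x * T := by
        have h : Real.sqrt N ≤ Real.sqrt x := by
          rcases le_or_gt 0 x with hx | hx
          · exact Real.sqrt_le_sqrt (Nat.floor_le hx)
          · rw [hN, Nat.floor_of_nonpos hx.le, Nat.cast_zero, Real.sqrt_zero]
            exact Real.sqrt_nonneg x
        gcongr

/-! ### `M_d(x)` split by `c = 0` / `c ≠ 0` -/

/-- The slice count `#{a ∈ [-N, N] : a² + c⁴ ≤ N}`. [folklore] -/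
def fiSliceCount (N : ℕ) (c : ℤ) : ℕ := #{a ∈ Icc (-(N : ℤ)) N | a ^ 2 + c ^ 4 ≤ (N : ℤ)}

/-- `M⁰_d(x) = ρ(0; d) (#{a : a² ≤ N} - 1)/d` (the `c = 0` part of the main term).
[cite: FriedlanderIwaniecAnnals1998, §3, terms with b = 0] -/
def fiMzero (x : ℝ) (d : ℕ) : ℝ := #(fiRoots 0 d) * ((fiSliceCount ⌊x⌋₊ 0 : ℝ) - 1) / d

/-- `M*_d(x) = d⁻¹ ∑_{c ∈ fiCRange} ρ(c²; d) #{a : a² + c⁴ ≤ N}` (the `c ≠ 0` part).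
[cite: FriedlanderIwaniecAnnals1998, §3, M_d(x) with b ≠ 0] -/
def fiMstar (x : ℝ) (d : ℕ) : ℝ :=
  (∑ c ∈ fiCRange ⌊x⌋₊, (#(fiRoots (c.natAbs ^ 2) d) : ℝ) * fiSliceCount ⌊x⌋₊ c) / d

/-- **`M_d(x) = M⁰_d(x) + M*_d(x)`** for `d ≥ 1` (from `mul_fiMainTerm_eq`, dropping the empty slices
`c⁴ > N`). [cite: FriedlanderIwaniecAnnals1998, §3] -/
theorem fiMainTerm_eq_fiMzero_add_fiMstar {d : ℕ} (hd : 0 < d) (x : ℝ) :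
    fiMainTerm d x = fiMzero x d + fiMstar x d := by
  set N := ⌊x⌋₊ with hN
  have hdr : (d : ℝ) ≠ 0 := by exact_mod_cast hd.ne'
  have h := mul_fiMainTerm_eq d x
  rw [← hN] at h
  simp_rw [sqCongrCount_neg_pow_four_eq_card, sqCongrCount_zero_eq_card] at h
  -- split off `c = 0` and restrict the rest to `fiCRange`
  have hsplit : ∑ c ∈ Icc (-(N : ℤ)) N, (#(fiRoots (c.natAbs ^ 2) d) : ℝ) * fiSliceCount N c =
      #(fiRoots 0 d) * fiSliceCount N 0 +
        ∑ c ∈ fiCRange N, (#(fiRoots (c.natAbs ^ 2) d) : ℝ) * fiSliceCount N c := by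
    rw [← add_sum_erase _ _ (show (0 : ℤ) ∈ Icc (-(N : ℤ)) N by simp)]
    congr 1
    symm
    refine sum_subset (fun c hc => ?_) (fun c hc hc' => ?_)
    · rw [← filter_Icc_eq_fiCRange, mem_filter] at hc
      exact mem_erase.mpr ⟨hc.2.1, hc.1⟩
    · rw [mem_erase] at hc
      rw [mem_fiCRange, not_and_or, not_not, not_le] at hc'
      rcases hc' with hc' | hc'
      · exact absurd hc' hc.1
      · rw [fiSliceCount, card_slice_eq_zero hc']
        simp
  have hM : fiMainTerm d x = (d * fiMainTerm d x) / d := by field_simp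
  rw [hM, h]
  unfold fiMzero fiMstar
  rw [show (fun c : ℤ => (#(fiRoots (c.natAbs ^ 2) d) : ℝ) *
      (#{a ∈ Icc (-(N : ℤ)) N | a ^ 2 + c ^ 4 ≤ (N : ℤ)} : ℝ)) =
      fun c => (#(fiRoots (c.natAbs ^ 2) d) : ℝ) * fiSliceCount N c from rfl, hsplit]
  field_simp
  ring

/-- `#{a : a² ≤ N} = 1 + #{a ≠ 0 : a² ≤ N}`. [folklore] -/
theorem fiSliceCount_zero_eq (N : ℕ) :
    fiSliceCount N 0 = 1 + #{a ∈ Icc (-(N : ℤ)) N | a ≠ 0 ∧ a ^ 2 ≤ (N : ℤ)} := by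
  rw [fiSliceCount]
  have h := card_filter_add_card_filter_not (s := {a ∈ Icc (-(N : ℤ)) N | a ^ 2 + 0 ^ 4 ≤ (N : ℤ)})
    (p := fun a : ℤ => a = 0)
  rw [filter_filter, filter_filter] at h
  rw [← h]
  congr 1
  · rw [card_eq_one]
    refine ⟨0, ?_⟩
    ext a
    simp only [mem_filter, mem_Icc, mem_singleton]
    constructor
    · exact fun h => h.2.2
    · rintro rfl; simp
  · congr 1
    ext a
    simp only [mem_filter, ne_eq, OfNat.ofNat_ne_zero, not_false_eq_true, zero_pow, add_zero]
    tauto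

/-- **`0 ≤ M⁰_d(x) ≤ 2√x ρ(0; d)/d`.** [cite: FriedlanderIwaniecAnnals1998, §3, "≪ √x/(d₁d₂)"] -/
theorem fiMzero_mem_Icc (x : ℝ) (d : ℕ) :
    fiMzero x d ∈ Set.Icc 0 (2 * Real.sqrt x * #(fiRoots 0 d) / d) := by
  set N := ⌊x⌋₊ with hN
  have h0 : (fiSliceCount N 0 : ℝ) - 1 = #{a ∈ Icc (-(N : ℤ)) N | a ≠ 0 ∧ a ^ 2 ≤ (N : ℤ)} := by
    rw [fiSliceCount_zero_eq]; push_cast; ring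
  have hle : (#{a ∈ Icc (-(N : ℤ)) N | a ≠ 0 ∧ a ^ 2 ≤ (N : ℤ)} : ℝ) ≤ 2 * Real.sqrt x := by
    refine (card_nonzero_sq_le N).trans ?_
    have h : Real.sqrt N ≤ Real.sqrt x := by
      rcases le_or_gt 0 x with hx | hx
      · exact Real.sqrt_le_sqrt (Nat.floor_le hx)
      · rw [hN, Nat.floor_of_nonpos hx.le, Nat.cast_zero, Real.sqrt_zero]
        exact Real.sqrt_nonneg x
    linarith
  rw [fiMzero, ← hN, h0, Set.mem_Icc]
  constructor
  · positivity
  · rcases Nat.eq_zero_or_pos d with rfl | hd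
    · simp
    · rw [div_le_div_iff_of_pos_right (by exact_mod_cast hd), mul_comm]
      gcongr

/-- **`∑_{d ≤ D} M⁰_d(x) ≤ 2√x (1 + log D)²`.** [cite: FriedlanderIwaniecAnnals1998, §3, terms with b = 0] -/
theorem sum_fiMzero_le (x : ℝ) (D : ℕ) :
    ∑ d ∈ Icc 1 D, fiMzero x d ≤ 2 * Real.sqrt x * (1 + Real.log D) ^ 2 := by
  calc ∑ d ∈ Icc 1 D, fiMzero x d ≤ ∑ d ∈ Icc 1 D, 2 * Real.sqrt x * #(fiRoots 0 d) / d :=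
        sum_le_sum fun d _ => (fiMzero_mem_Icc x d).2
    _ = 2 * Real.sqrt x * ∑ d ∈ Icc 1 D, (#(fiRoots 0 d) : ℝ) / d := by
        rw [mul_sum]
        exact sum_congr rfl fun d _ => by ring
    _ ≤ 2 * Real.sqrt x * (1 + Real.log D) ^ 2 :=
        mul_le_mul_of_nonneg_left (sum_card_fiRoots_zero_div_le D) (by positivity)

/-! ### The smoothed objects and (3.10) -/

/-- `A*_d(f) = ∑_{c ∈ fiCRange} ∑_{d ∣ a² + c⁴} f(a² + c⁴)` (real parts of the slices `fiSmoothSlice`).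
[cite: FriedlanderIwaniecAnnals1998, §3, A_d(f)] -/
def fiAstarSmooth (x y : ℝ) (d : ℕ) : ℝ := ∑ c ∈ fiCRange ⌊x⌋₊, (fiSmoothSlice x y d c).re

/-- `M*_d(f) = d⁻¹ ∑_{c ∈ fiCRange} ρ(c²; d) 𝓕F_c(0)` (`𝓕F_c(0) = ∫ f(t² + c⁴) dt = I(0, b; d)`).
[cite: FriedlanderIwaniecAnnals1998, §3, M_d(f)] -/
def fiMstarSmooth (x y : ℝ) (d : ℕ) : ℝ :=
  (∑ c ∈ fiCRange ⌊x⌋₊, (#(fiRoots (c.natAbs ^ 2) d) : ℝ) *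
    (𝓕 (fiProfileC x y ((c : ℝ) ^ 4)) 0).re) / d

/-- The oscillatory remainder `E_d = A*_d(f) - M*_d(f)` (the terms `k ≠ 0` of (3.11)).
[cite: FriedlanderIwaniecAnnals1998, §3 (3.11)] -/
def fiE (x y : ℝ) (d : ℕ) : ℝ := fiAstarSmooth x y d - fiMstarSmooth x y d

/-- The strip count in the slice `c` for the modulus `d`:
`#{a : ⌊x - y⌋ < a² + c⁴ ≤ ⌊x⌋, d ∣ a² + c⁴}`. [cite: FriedlanderIwaniecAnnals1998, §3 (3.10)] -/
def fiStripSlice (x y : ℝ) (d : ℕ) (c : ℤ) : ℕ :=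
  #{a ∈ Icc (-(⌊x⌋₊ : ℤ)) ⌊x⌋₊ | (⌊x - y⌋₊ : ℤ) < a ^ 2 + c ^ 4 ∧ a ^ 2 + c ^ 4 ≤ (⌊x⌋₊ : ℤ) ∧
    (d : ℤ) ∣ a ^ 2 + c ^ 4}

/-- The real part of a slice is the real smoothed sum. [folklore] -/
theorem fiSmoothSlice_re (x y : ℝ) (d : ℕ) (c : ℤ) :
    (fiSmoothSlice x y d c).re = ∑ a ∈ (Icc (-(⌊x⌋₊ : ℤ)) ⌊x⌋₊).filter
      (fun a => (d : ℤ) ∣ a ^ 2 + c ^ 4), fiCutoff x y (((a : ℝ)) ^ 2 + (c : ℝ) ^ 4) := by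
  rw [fiSmoothSlice_def, Complex.re_sum]
  refine sum_congr rfl fun a _ => ?_
  rw [fiProfileC, Complex.ofReal_re]

/-- **(3.10) per slice**: for `c` with `c⁴ ≤ ⌊x⌋` (`x ≥ 1`, `0 < y ≤ x`),
`0 ≤ #{a : a² + c⁴ ≤ ⌊x⌋, d ∣ a² + c⁴} - ∑_{d ∣ a² + c⁴} f(a² + c⁴) ≤ #strip_c(d)`: the summands agree
unless `⌊x - y⌋ < a² + c⁴ ≤ ⌊x⌋`, where they differ by at most `1`.
[cite: FriedlanderIwaniecAnnals1998, §3 (3.10)] -/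
theorem slice_sub_smooth_mem_Icc {x y : ℝ} (hy : 0 < y) (hyx : y ≤ x) (d : ℕ) (c : ℤ) :
    (#{a ∈ Icc (-(⌊x⌋₊ : ℤ)) ⌊x⌋₊ | a ^ 2 + c ^ 4 ≤ (⌊x⌋₊ : ℤ) ∧ (d : ℤ) ∣ a ^ 2 + c ^ 4} : ℝ) -
        (fiSmoothSlice x y d c).re ∈ Set.Icc (0 : ℝ) (fiStripSlice x y d c) := by
  set N := ⌊x⌋₊ with hN
  set N' := ⌊x - y⌋₊ with hN'
  rw [fiSmoothSlice_re, fiStripSlice, ← hN, ← hN']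
  -- write everything as sums over `a ∈ [-N, N]` with `d ∣ a² + c⁴`
  set S := (Icc (-(N : ℤ)) N).filter (fun a => (d : ℤ) ∣ a ^ 2 + c ^ 4) with hS
  have hA : (#{a ∈ Icc (-(N : ℤ)) N | a ^ 2 + c ^ 4 ≤ (N : ℤ) ∧ (d : ℤ) ∣ a ^ 2 + c ^ 4} : ℝ) =
      ∑ a ∈ S, if a ^ 2 + c ^ 4 ≤ (N : ℤ) then (1 : ℝ) else 0 := by
    rw [hS, sum_filter, card_eq_sum_ones, sum_filter]
    push_cast
    refine sum_congr rfl fun a _ => ?_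
    by_cases h1 : a ^ 2 + c ^ 4 ≤ (N : ℤ) <;> by_cases h2 : (d : ℤ) ∣ a ^ 2 + c ^ 4 <;> simp [h1, h2]
  have hB : (#{a ∈ Icc (-(N : ℤ)) N | (N' : ℤ) < a ^ 2 + c ^ 4 ∧ a ^ 2 + c ^ 4 ≤ (N : ℤ) ∧
      (d : ℤ) ∣ a ^ 2 + c ^ 4} : ℝ) =
      ∑ a ∈ S, if (N' : ℤ) < a ^ 2 + c ^ 4 ∧ a ^ 2 + c ^ 4 ≤ (N : ℤ) then (1 : ℝ) else 0 := by
    rw [hS, sum_filter, card_eq_sum_ones, sum_filter]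
    push_cast
    refine sum_congr rfl fun a _ => ?_
    by_cases h1 : (N' : ℤ) < a ^ 2 + c ^ 4 ∧ a ^ 2 + c ^ 4 ≤ (N : ℤ) <;>
      by_cases h2 : (d : ℤ) ∣ a ^ 2 + c ^ 4 <;> simp [h1, h2]
  rw [hA, hB, ← sum_sub_distrib, Set.mem_Icc]
  -- termwise comparison
  have hterm : ∀ a : ℤ, (if a ^ 2 + c ^ 4 ≤ (N : ℤ) then (1 : ℝ) else 0) -
      fiCutoff x y ((a : ℝ) ^ 2 + (c : ℝ) ^ 4) ∈ Set.Icc (0 : ℝ)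
        (if (N' : ℤ) < a ^ 2 + c ^ 4 ∧ a ^ 2 + c ^ 4 ≤ (N : ℤ) then (1 : ℝ) else 0) := by
    intro a
    have hf := fiCutoff_mem_Icc x y ((a : ℝ) ^ 2 + (c : ℝ) ^ 4)
    have hcast : (((a ^ 2 + c ^ 4 : ℤ)) : ℝ) = (a : ℝ) ^ 2 + (c : ℝ) ^ 4 := by push_cast; ring
    by_cases h1 : a ^ 2 + c ^ 4 ≤ (N : ℤ)
    · rw [if_pos h1]
      by_cases h2 : (N' : ℤ) < a ^ 2 + c ^ 4
      · rw [if_pos ⟨h2, h1⟩, Set.mem_Icc]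
        constructor <;> linarith [hf.1, hf.2]
      · -- `a² + c⁴ ≤ N' ≤ x - y`: `f = 1`
        rw [if_neg (fun h => h2 h.1), fiCutoff_eq_one hy]
        · simp
        · rw [not_lt] at h2
          have : (a : ℝ) ^ 2 + (c : ℝ) ^ 4 ≤ N' := by rw [← hcast]; exact_mod_cast h2
          exact this.trans (Nat.floor_le (by linarith))
    · -- `a² + c⁴ ≥ N + 1 > x`: `f = 0`
      rw [if_neg h1, if_neg (fun h => h1 h.2), fiCutoff_eq_zero hy]
      · simp
      · rw [not_le] at h1
        have h1' : (N : ℤ) + 1 ≤ a ^ 2 + c ^ 4 := h1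
        have : (N : ℝ) + 1 ≤ (a : ℝ) ^ 2 + (c : ℝ) ^ 4 := by rw [← hcast]; exact_mod_cast h1'
        exact (Nat.lt_floor_add_one x).le.trans this
  exact ⟨sum_nonneg fun a _ => (hterm a).1, sum_le_sum fun a _ => (hterm a).2⟩

/-- **(3.10)**: `0 ≤ A*_d(x) - A*_d(f) ≤ ∑_{c ∈ fiCRange} #strip_c(d)`.
[cite: FriedlanderIwaniecAnnals1998, §3 (3.10)] -/
theorem fiAstar_sub_smooth_mem_Icc {x y : ℝ} (hy : 0 < y) (hyx : y ≤ x) (d : ℕ) :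
    (fiAstar x d : ℝ) - fiAstarSmooth x y d ∈
      Set.Icc (0 : ℝ) (∑ c ∈ fiCRange ⌊x⌋₊, (fiStripSlice x y d c : ℝ)) := by
  rw [fiAstar_eq_sum, fiAstarSmooth, ← sum_sub_distrib, Set.mem_Icc]
  exact ⟨sum_nonneg fun c _ => (slice_sub_smooth_mem_Icc hy hyx d c).1,
    sum_le_sum fun c _ => (slice_sub_smooth_mem_Icc hy hyx d c).2⟩

/-- **(3.10) summed over `d ≤ D`**: `∑_{d ≤ D} ∑_c #strip_c(d) ≤ T · #strip`, `τ ≤ T` on `[1, ⌊x⌋]`,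
where the strip is `{(a, c) : ⌊x - y⌋ < a² + c⁴ ≤ ⌊x⌋}` (counted by `strip_count_le`).
[cite: FriedlanderIwaniecAnnals1998, §3 (3.10)] -/
theorem sum_sum_fiStripSlice_le {x y : ℝ} {T : ℕ} (hT : ∀ n : ℕ, n ≠ 0 → n ≤ ⌊x⌋₊ → #n.divisors ≤ T)
    (D : ℕ) :
    ∑ d ∈ Icc 1 D, ∑ c ∈ fiCRange ⌊x⌋₊, (fiStripSlice x y d c : ℝ) ≤
      T * #((fiDisc ⌊x⌋₊).filter (fun ac => (⌊x - y⌋₊ : ℤ) < ac.1 ^ 2 + ac.2 ^ 4)) := by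
  set N := ⌊x⌋₊ with hN
  set N' := ⌊x - y⌋₊ with hN'
  -- the strip pairs `(a, c)` with `c ∈ fiCRange`
  set P : Finset (ℤ × ℤ) := ((Icc (-(N : ℤ)) N) ×ˢ fiCRange N).filter
    (fun ac => (N' : ℤ) < ac.1 ^ 2 + ac.2 ^ 4 ∧ ac.1 ^ 2 + ac.2 ^ 4 ≤ (N : ℤ)) with hP
  have hstep1 : ∀ d : ℕ, ∑ c ∈ fiCRange N, (fiStripSlice x y d c : ℝ) =
      #(P.filter (fun ac => (d : ℤ) ∣ ac.1 ^ 2 + ac.2 ^ 4)) := by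
    intro d
    rw [hP, filter_filter, card_eq_sum_ones, sum_filter, sum_product_right]
    push_cast
    refine sum_congr rfl fun c _ => ?_
    rw [fiStripSlice, ← hN, ← hN', card_eq_sum_ones, sum_filter]
    push_cast
    simp only [and_assoc]
  have hPsub : P ⊆ (fiDisc N).filter (fun ac => (N' : ℤ) < ac.1 ^ 2 + ac.2 ^ 4) := by
    intro ac hac
    rw [hP, mem_filter, mem_product] at hac
    rw [mem_filter, fiDisc, mem_filter, fiBox, mem_product]
    refine ⟨⟨⟨hac.1.1, ?_⟩, hac.2.2⟩, hac.2.1⟩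
    have := hac.1.2
    rw [← filter_Icc_eq_fiCRange, mem_filter] at this
    exact this.1
  have hq : ∀ ac ∈ P, (ac.1 ^ 2 + ac.2 ^ 4).toNat ≠ 0 ∧ (ac.1 ^ 2 + ac.2 ^ 4).toNat ≤ N := by
    intro ac hac
    rw [hP, mem_filter] at hac
    have h0 : (0 : ℤ) ≤ ac.1 ^ 2 + ac.2 ^ 4 := by positivity
    constructor
    · intro h
      have := (Int.toNat_eq_zero).mp h
      have : (N' : ℤ) < 0 := hac.2.1.trans_le this
      have : (0 : ℤ) ≤ N' := by positivity
      omega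
    · exact Int.toNat_le.mpr hac.2.2
  simp_rw [hstep1]
  calc ∑ d ∈ Icc 1 D, (#(P.filter (fun ac => (d : ℤ) ∣ ac.1 ^ 2 + ac.2 ^ 4)) : ℝ)
      = ∑ ac ∈ P, (#((Icc 1 D).filter fun d : ℕ => (d : ℤ) ∣ ac.1 ^ 2 + ac.2 ^ 4) : ℝ) := by
        simp only [card_filter, Nat.cast_sum, Nat.cast_ite, Nat.cast_one, Nat.cast_zero]
        exact sum_comm
    _ ≤ ∑ ac ∈ P, (T : ℝ) := by
        refine sum_le_sum fun ac hac => ?_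
        obtain ⟨hq0, hqN⟩ := hq ac hac
        have hsub : ((Icc 1 D).filter fun d : ℕ => (d : ℤ) ∣ ac.1 ^ 2 + ac.2 ^ 4) ⊆
            ((ac.1 ^ 2 + ac.2 ^ 4).toNat).divisors := by
          intro d hd
          rw [mem_filter] at hd
          rw [Nat.mem_divisors]
          refine ⟨?_, hq0⟩
          have h0 : (0 : ℤ) ≤ ac.1 ^ 2 + ac.2 ^ 4 := by positivity
          have := hd.2
          rw [← Int.toNat_of_nonneg h0, Int.natCast_dvd_natCast] at this
          exact this
        calc (#((Icc 1 D).filter fun d : ℕ => (d : ℤ) ∣ ac.1 ^ 2 + ac.2 ^ 4) : ℝ)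
            ≤ #((ac.1 ^ 2 + ac.2 ^ 4).toNat).divisors := by exact_mod_cast card_le_card hsub
          _ ≤ T := by exact_mod_cast hT _ hq0 hqN
    _ = T * #P := by rw [sum_const, nsmul_eq_mul, mul_comm]
    _ ≤ T * #((fiDisc N).filter (fun ac => (N' : ℤ) < ac.1 ^ 2 + ac.2 ^ 4)) := by
        gcongr

/-! ### (3.12): the expected main terms, via Poisson at `d = 1` -/

/-- At `d = 1` every residue is a root: `ρ̃(k, ℓ; 1) = 1`. [folklore] -/
theorem fiWeylInt_one (k : ℤ) (ℓ : ℕ) : fiWeylInt k ℓ 1 = 1 := by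
  have h : fiRoots ℓ 1 = {0} := by
    ext ν
    simp [mem_fiRoots]
  rw [fiWeylInt_def, h, sum_singleton]
  simp only [Nat.cast_zero, zero_mul, zero_div, LargeSieve.e_zero]

/-- The Poisson error at `d = 1`: `P_c = ∑_a F_c(a) - 𝓕F_c(0) = ∑_{k ≠ 0} 𝓕F_c(k)`.
[cite: FriedlanderIwaniecAnnals1998, §3, "the integral approximates to the sum"] -/
def fiPoissonErr (x y : ℝ) (c : ℤ) : ℂ :=
  fiSmoothSlice x y 1 c - 𝓕 (fiProfileC x y ((c : ℝ) ^ 4)) 0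

/-- `∑_{a} F_c(a) = 𝓕F_c(0) + P_c` with `P_c = ∑_{k ≥ 1} (𝓕F_c(k) + 𝓕F_c(-k))`.
[cite: FriedlanderIwaniecAnnals1998, §3 (3.11) at d = 1] -/
theorem fiPoissonErr_eq {x y : ℝ} (hx : 1 ≤ x) (hy : 0 < y) (hyx : y ≤ x) (c : ℤ) :
    fiPoissonErr x y c = ∑' n : ℕ, (𝓕 (fiProfileC x y ((c : ℝ) ^ 4)) ((n : ℝ) + 1) +
      𝓕 (fiProfileC x y ((c : ℝ) ^ 4)) (-((n : ℝ) + 1))) := by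
  set F := fiProfileC x y ((c : ℝ) ^ 4) with hF
  have hFd : ContDiff ℝ ∞ F := contDiff_fiProfileC _ _ _
  have hFc : HasCompactSupport F := hasCompactSupport_fiProfileC hy (by positivity) (hy.le.trans hyx)
  have hsum : Summable fun k : ℤ => 𝓕 F k := by
    simpa using summable_fourier_div hFd hFc one_pos
  have h1 : fiSmoothSlice x y 1 c = ∑' k : ℤ, 𝓕 F k := by
    rw [fiSmoothSlice_eq_tsum hx hy one_pos c]
    simp [fiWeylInt_one, ← hF]
  have hnat : Summable fun n : ℕ => 𝓕 F n := hsum.comp_injective Nat.cast_injective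
  have hneg : Summable fun n : ℕ => 𝓕 F (-((n : ℝ) + 1)) := by
    have := hsum.comp_injective (show Function.Injective fun n : ℕ => -((n : ℤ) + 1) from
      fun a b h => by simpa using h)
    refine this.congr fun n => ?_
    simp
  have hnat1 : Summable fun n : ℕ => 𝓕 F ((n : ℝ) + 1) := by
    have := (summable_nat_add_iff 1).mpr hnat
    refine this.congr fun n => ?_
    simp
  rw [fiPoissonErr, h1, ← hF, tsum_of_nat_of_neg_add_one (f := fun k : ℤ => 𝓕 F k)
    (by simpa using hnat) (by simpa using hneg)]
  push_cast
  rw [hnat.tsum_eq_zero_add]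
  push_cast
  rw [hnat1.tsum_add hneg]
  ring

/-- **The Poisson error at `d = 1`**: `|P_c| ≤ 4 · (2√x n! Mₙ (2√x/y)ⁿ) · (2π)^{-n}` (from `n ≥ 2`
partial integrations and `∑_{k ≥ 1} k⁻² ≤ 2`). [cite: FriedlanderIwaniecAnnals1998, §3 (3.12)] -/
theorem norm_fiPoissonErr_le {x y : ℝ} (hx : 1 ≤ x) (hy : 0 < y) (hyx : y ≤ x) (c : ℤ) {n : ℕ}
    (hn : 2 ≤ n) {M : ℝ} (hM0 : 0 ≤ M)
    (hM : ∀ i ≤ n, ∀ s : ℝ, ‖iteratedFDeriv ℝ i Real.smoothTransition s‖ ≤ M) :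
    ‖fiPoissonErr x y c‖ ≤ 4 * (2 * Real.sqrt x * (n.factorial * M * (2 * Real.sqrt x / y) ^ n)) *
      ((1 : ℝ) / (2 * π)) ^ n := by
  set F := fiProfileC x y ((c : ℝ) ^ 4) with hF
  have hFd : ContDiff ℝ ∞ F := contDiff_fiProfileC _ _ _
  have hFc : HasCompactSupport F := hasCompactSupport_fiProfileC hy (by positivity) (hy.le.trans hyx)
  set L : ℝ := ∫ t, ‖iteratedDeriv n F t‖ with hL
  have hL0 : 0 ≤ L := integral_nonneg fun _ => norm_nonneg _
  have hLle : L ≤ 2 * Real.sqrt x * (n.factorial * M * (2 * Real.sqrt x / y) ^ n) :=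
    integral_norm_iteratedDeriv_fiProfileC_le hy hyx (by positivity) hM0 hM
  set B : ℝ := L * ((1 : ℝ) / (2 * π)) ^ n with hB
  have hB0 : 0 ≤ B := by positivity
  -- each term
  have hk : ∀ (m : ℕ) (σ : ℝ), σ = 1 ∨ σ = -1 →
      ‖𝓕 F (σ * ((m : ℝ) + 1))‖ ≤ B * (((m + 1 : ℕ) : ℝ) ^ 2)⁻¹ := by
    intro m σ hσ
    have habs : |σ * ((m : ℝ) + 1)| = (m : ℝ) + 1 := by
      rcases hσ with rfl | rfl
      · rw [one_mul, abs_of_pos (by positivity)]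
      · rw [neg_one_mul, abs_neg, abs_of_pos (by positivity)]
    have h := norm_fourier_div_le hFd hFc n one_pos (k := σ * ((m : ℝ) + 1))
      (by rw [habs]; positivity)
    rw [div_one, habs] at h
    refine h.trans ?_
    rw [hB]
    refine mul_le_mul_of_nonneg_left ?_ (by positivity)
    push_cast
    rw [inv_le_inv₀ (by positivity) (by positivity)]
    exact pow_le_pow_right₀ (by linarith [(Nat.cast_nonneg m : (0 : ℝ) ≤ m)]) hn
  rw [fiPoissonErr_eq hx hy hyx c, ← hF]
  have hsumm : Summable fun m : ℕ => ‖𝓕 F ((m : ℝ) + 1) + 𝓕 F (-((m : ℝ) + 1))‖ := by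
    refine Summable.of_nonneg_of_le (fun _ => norm_nonneg _) (fun m => ?_)
      ((summable_nat_add_iff 1).mpr
        ((Real.summable_nat_pow_inv.mpr one_lt_two).mul_left (2 * B)))
    have h1 := hk m 1 (Or.inl rfl)
    have h2 := hk m (-1) (Or.inr rfl)
    rw [one_mul] at h1
    rw [neg_one_mul] at h2
    calc ‖𝓕 F ((m : ℝ) + 1) + 𝓕 F (-((m : ℝ) + 1))‖
        ≤ ‖𝓕 F ((m : ℝ) + 1)‖ + ‖𝓕 F (-((m : ℝ) + 1))‖ := norm_add_le _ _
      _ ≤ 2 * B * (((m + 1 : ℕ) : ℝ) ^ 2)⁻¹ := by linarith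
  refine (norm_tsum_le_tsum_norm hsumm).trans ?_
  refine tsum_le_of_sum_range_le (fun _ => norm_nonneg _) fun m => ?_
  calc ∑ i ∈ range m, ‖𝓕 F ((i : ℝ) + 1) + 𝓕 F (-((i : ℝ) + 1))‖
      ≤ ∑ i ∈ range m, 2 * B * ((((i + 1 : ℕ) : ℝ)) ^ 2)⁻¹ := by
        refine sum_le_sum fun i _ => ?_
        have h1 := hk i 1 (Or.inl rfl)
        have h2 := hk i (-1) (Or.inr rfl)
        rw [one_mul] at h1
        rw [neg_one_mul] at h2
        calc ‖𝓕 F ((i : ℝ) + 1) + 𝓕 F (-((i : ℝ) + 1))‖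
            ≤ ‖𝓕 F ((i : ℝ) + 1)‖ + ‖𝓕 F (-((i : ℝ) + 1))‖ := norm_add_le _ _
          _ ≤ 2 * B * (((i + 1 : ℕ) : ℝ) ^ 2)⁻¹ := by linarith
    _ = 2 * B * ∑ k ∈ Icc 1 m, ((k : ℝ) ^ 2)⁻¹ := by
        rw [mul_sum]
        refine sum_nbij' (fun i => i + 1) (fun k => k - 1) ?_ ?_ ?_ ?_ ?_
        · intro i hi; rw [mem_range] at hi; rw [mem_Icc]; omega
        · intro k hk; rw [mem_Icc] at hk; rw [mem_range]; omega
        · intro i _; omega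
        · intro k hk; rw [mem_Icc] at hk; omega
        · intro i _; rfl
    _ ≤ 2 * B * 2 := mul_le_mul_of_nonneg_left (sum_Icc_inv_sq_le_two m) (by positivity)
    _ ≤ 4 * (2 * Real.sqrt x * (n.factorial * M * (2 * Real.sqrt x / y) ^ n)) *
          ((1 : ℝ) / (2 * π)) ^ n := by
        rw [hB]
        have : L * ((1 : ℝ) / (2 * π)) ^ n ≤ (2 * Real.sqrt x * (n.factorial * M *
            (2 * Real.sqrt x / y) ^ n)) * ((1 : ℝ) / (2 * π)) ^ n :=
          mul_le_mul_of_nonneg_right hLle (by positivity)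
        linarith

/-- **(3.12) pointwise**: `|M*_d(x) - M*_d(f)| ≤ d⁻¹ ∑_{c ∈ fiCRange} ρ(c²; d) (#strip_c(1) + |P_c|)`:
`#{a : a² + c⁴ ≤ N} - 𝓕F_c(0) = (#{…} - ∑_a f) + P_c` and `0 ≤ #{…} - ∑_a f ≤ #strip_c(1)` by the
`d = 1` case of (3.10). [cite: FriedlanderIwaniecAnnals1998, §3 (3.12)] -/
theorem abs_fiMstar_sub_smooth_le {x y : ℝ} (hy : 0 < y) (hyx : y ≤ x) (d : ℕ) :
    |fiMstar x d - fiMstarSmooth x y d| ≤ (∑ c ∈ fiCRange ⌊x⌋₊,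
      (#(fiRoots (c.natAbs ^ 2) d) : ℝ) * (fiStripSlice x y 1 c + ‖fiPoissonErr x y c‖)) / d := by
  rcases Nat.eq_zero_or_pos d with rfl | hd
  · simp [fiMstar, fiMstarSmooth]
  have hdr : (0 : ℝ) < d := by exact_mod_cast hd
  rw [fiMstar, fiMstarSmooth, ← sub_div, abs_div, abs_of_pos hdr, div_le_div_iff_of_pos_right hdr,
    ← sum_sub_distrib]
  refine (abs_sum_le_sum_abs _ _).trans (sum_le_sum fun c _ => ?_)
  rw [← mul_sub, abs_mul, abs_of_nonneg (Nat.cast_nonneg _)]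
  refine mul_le_mul_of_nonneg_left ?_ (Nat.cast_nonneg _)
  -- the slice at `d = 1`
  have hslice := slice_sub_smooth_mem_Icc hy hyx 1 c
  have hcount : (#{a ∈ Icc (-(⌊x⌋₊ : ℤ)) ⌊x⌋₊ | a ^ 2 + c ^ 4 ≤ (⌊x⌋₊ : ℤ) ∧ ((1 : ℕ) : ℤ) ∣ a ^ 2 + c ^ 4} : ℝ)
      = fiSliceCount ⌊x⌋₊ c := by
    rw [fiSliceCount]
    congr 2
    exact filter_congr fun a _ => by simp
  rw [hcount] at hslice
  have hre : (𝓕 (fiProfileC x y ((c : ℝ) ^ 4)) 0).re =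
      (fiSmoothSlice x y 1 c).re - (fiPoissonErr x y c).re := by
    rw [fiPoissonErr, Complex.sub_re]; ring
  rw [hre, show (fiSliceCount ⌊x⌋₊ c : ℝ) - ((fiSmoothSlice x y 1 c).re - (fiPoissonErr x y c).re) =
    ((fiSliceCount ⌊x⌋₊ c : ℝ) - (fiSmoothSlice x y 1 c).re) + (fiPoissonErr x y c).re by ring]
  refine (abs_add_le _ _).trans (add_le_add ?_ ((Complex.abs_re_le_norm _)))
  rw [abs_of_nonneg hslice.1]
  exact hslice.2

/-! ### The pointwise decomposition of `A_d(x) - M_d(x)` -/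

/-- **`|A_d(x) - M_d(x)| ≤ A⁰_d + M⁰_d + (A*_d - A*_d(f)) + |E_d| + |M*_d - M*_d(f)|`** with the
bounds of this file substituted. [cite: FriedlanderIwaniecAnnals1998, §3, proof of Lemma 3.1] -/
theorem abs_congrSum_sub_fiMainTerm_le {x y : ℝ} (hy : 0 < y) (hyx : y ≤ x) {d : ℕ} (hd : 0 < d) :
    |fiSieveSeq.congrSum d x - fiMainTerm d x| ≤
      fiAzero x d + fiMzero x d + ∑ c ∈ fiCRange ⌊x⌋₊, (fiStripSlice x y d c : ℝ) + |fiE x y d| +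
        (∑ c ∈ fiCRange ⌊x⌋₊, (#(fiRoots (c.natAbs ^ 2) d) : ℝ) *
          (fiStripSlice x y 1 c + ‖fiPoissonErr x y c‖)) / d := by
  rw [congrSum_eq_fiAzero_add_fiAstar, fiMainTerm_eq_fiMzero_add_fiMstar hd]
  have hA := fiAstar_sub_smooth_mem_Icc hy hyx d (x := x)
  have hM := abs_fiMstar_sub_smooth_le hy hyx d (x := x)
  have hA0 : (0 : ℝ) ≤ fiAzero x d := Nat.cast_nonneg _
  have hM0 : 0 ≤ fiMzero x d := (fiMzero_mem_Icc x d).1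
  have key : (fiAzero x d : ℝ) + fiAstar x d - (fiMzero x d + fiMstar x d) =
      (fiAzero x d - fiMzero x d) + (fiAstar x d - fiAstarSmooth x y d) + fiE x y d +
        (fiMstarSmooth x y d - fiMstar x d) := by rw [fiE]; ring
  rw [key]
  have h1 : |(fiAzero x d : ℝ) - fiMzero x d| ≤ fiAzero x d + fiMzero x d := by
    rw [abs_le]; constructor <;> linarith
  have h2 : |(fiAstar x d : ℝ) - fiAstarSmooth x y d| ≤ ∑ c ∈ fiCRange ⌊x⌋₊, (fiStripSlice x y d c : ℝ) := by
    rw [abs_of_nonneg hA.1]; exact hA.2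
  have h3 : |fiMstarSmooth x y d - fiMstar x d| ≤ (∑ c ∈ fiCRange ⌊x⌋₊,
      (#(fiRoots (c.natAbs ^ 2) d) : ℝ) * (fiStripSlice x y 1 c + ‖fiPoissonErr x y c‖)) / d := by
    rw [abs_sub_comm]; exact hM
  calc |(fiAzero x d : ℝ) - fiMzero x d + (fiAstar x d - fiAstarSmooth x y d) + fiE x y d +
        (fiMstarSmooth x y d - fiMstar x d)|
      ≤ |(fiAzero x d : ℝ) - fiMzero x d| + |(fiAstar x d : ℝ) - fiAstarSmooth x y d| +
          |fiE x y d| + |fiMstarSmooth x y d - fiMstar x d| := by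
        refine (abs_add_le _ _).trans (add_le_add ((abs_add_le _ _).trans
          (add_le_add (abs_add_le _ _) le_rfl)) le_rfl)
    _ ≤ _ := by linarith

end Literature.NumberTheory.Sieve.FriedlanderIwaniecPrimes
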